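import Mathlib
import Summits.MatrixMultiplication.MatrixMultiplication.Theses.GLnSeparatingDesigns
import Summits.MatrixMultiplication.MatrixMultiplication.Theorems.SeparationDegreeCost.Negative.FixedTolerance
import Literature.Computability.AlgebraicComplexity.MatrixMultiplicationExponent
import Literature.Computability.AlgebraicComplexity.FlatteningBound

/-!
# `GLnSeparatingDesigns.SeparationDegreeCost` (stmt-MatrixMultiplication-18361) — Negative lane II:
# the binomial factor and the clause `2 ≤ s`

Sequel of `Negative/FixedTolerance.lean` (same conventions: no Theses statement asserted positively;
`DesignAt`, `Conclusion`, `designAt_of_points`, `toGL`, `two_ip_succ_le` from there).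

* `separationDegreeCost_noBinomial_false` — the factor `C(s+n², n²)` cannot be dropped from the bound
  (deleting it is a strengthening, `separationDegreeCost_of_noBinomial`; strengthened statements are written out inline, not named): `n = 3`, `s = 2`,
  `Y = Z = {1}`, `X` = the `33` matrices `I + E`, `E` a `0/1` matrix with exactly two ones and
  `det (I+E) ≠ 0` (`fam2`, by `decide`), EXACTLY separated in degree `2` by `u(u−1)/2`,
  `u(g) = Σ_{E₀(ij)=1} (g_{ij} − δ_{ij})` (two distinct weight-two patterns overlap in `≤ 1` place); and
  `33^{ω/3} ≥ 33^{2/3} > 8 ≥ 8^{ω−2}` using only `2 ≤ ω ≤ 3`.  (The factor `s^{C(n,2)(ω−2)}` cannot be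
  shown necessary inside the tree: that would need `ω > 2`.)
* `omega_eq_two_of_separationDegreeCost_anyDegree` — the clause `2 ≤ s` is load-bearing only through
  a junk value: with it deleted, `s = 0` and `X = Y = Z = {1}`, `p = 1` give `1 ≤ 0^{3(ω−2)} · 1`, i.e.
  `ω = 2` (`0^0 = 1`, `0^t = 0` for `t ≠ 0`).  So a proof of the crux must use `1 ≤ s` (the `rpow`
  base), and the deleted variant is exactly as hard as the summit.
-/

-- `Summit.<S>.<S>.…` repeats `MatrixMultiplication` (summit = sub-problem) by design (lakefile: linter off).
set_option linter.dupNamespace false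

namespace Summit.MatrixMultiplication.MatrixMultiplication.Theorems

open scoped BigOperators
open Literature.Computability.AlgebraicComplexity
open Summit.MatrixMultiplication.MatrixMultiplication.Theses.GLnSeparatingDesigns (SeparationDegreeCost)

namespace SeparationDegreeCostNeg

/-! ## The binomial factor cannot be dropped: 33 exactly separated points -/

/-- The `0/1` pattern `E`. [folklore] -/
def patB (f : Fin 3 → Fin 3 → Bool) : Fin 3 → Fin 3 → ℤ := fun i j => if f i j then 1 else 0

/-- `I + E`. [folklore] -/
def matB (f : Fin 3 → Fin 3 → Bool) : Fin 3 → Fin 3 → ℤ :=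
  fun i j => patB f i j + if i = j then 1 else 0

/-- Overlap of two patterns (number of common ones). [folklore] -/
def ov (f g : Fin 3 → Fin 3 → Bool) : ℤ := ip (patB f) (patB g)

/-- Weight-`2` patterns `E` with `det (I + E) ≠ 0` (33 of the 36). [folklore] -/
def fam2 : Finset (Fin 3 → Fin 3 → Bool) :=
  Finset.univ.filter fun f => ov f f = 2 ∧ det3 (matB f) ≠ 0

/-- `33` of the `36` weight-two patterns give an invertible `I + E` (by `decide`). [folklore] -/
theorem fam2_card : fam2.card = 33 := by decide

/-- Members of `fam2` are invertible. [folklore] -/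
theorem fam2_det {f : Fin 3 → Fin 3 → Bool} (h : f ∈ fam2) : det3 (matB f) ≠ 0 :=
  (Finset.mem_filter.1 h).2.2

/-- Members of `fam2` have weight two. [folklore] -/
theorem fam2_ov_self {f : Fin 3 → Fin 3 → Bool} (h : f ∈ fam2) : ov f f = 2 :=
  (Finset.mem_filter.1 h).2.1

/-- A pattern is determined by its `0/1` matrix. [folklore] -/
theorem patB_injective : Function.Injective patB := by
  intro f g h
  funext i j
  have := congrFun (congrFun h i) j
  revert this
  unfold patB
  cases f i j <;> cases g i j <;> simp

/-- A pattern is determined by `I + E`. [folklore] -/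
theorem matB_injective : Function.Injective matB := by
  intro f g h
  refine patB_injective (funext fun i => funext fun j => ?_)
  have := congrFun (congrFun h i) j
  simpa [matB] using this

/-- Pattern entries are non-negative. [folklore] -/
theorem patB_nonneg (f : Fin 3 → Fin 3 → Bool) (i j : Fin 3) : 0 ≤ patB f i j := by
  unfold patB; split <;> norm_num

/-- Two distinct weight-`2` patterns overlap in `0` or `1` places. [folklore] -/
theorem fam2_ov_ne {f g : Fin 3 → Fin 3 → Bool} (hf : f ∈ fam2) (hg : g ∈ fam2) (hne : f ≠ g) :
    ov f g = 0 ∨ ov f g = 1 := by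
  have hne' : patB f ≠ patB g := fun h => hne (patB_injective h)
  have h1 := two_ip_succ_le hne'
  have h2 : 0 ≤ ov f g := by
    unfold ov ip
    exact Finset.sum_nonneg fun i _ => Finset.sum_nonneg fun j _ =>
      mul_nonneg (patB_nonneg f i j) (patB_nonneg g i j)
  have hff := fam2_ov_self hf
  have hgg := fam2_ov_self hg
  unfold ov at *
  omega

/-- The exact separator of the target `I + E₀`: `u(u-1)/2`, `u(g) = Σ_{E₀(ij)=1} (g_{ij} − δ_{ij})`.
[folklore] -/
noncomputable def linB (f : Fin 3 → Fin 3 → Bool) : MvPolynomial (Fin 3 × Fin 3) ℂ :=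
  ∑ i, ∑ j, MvPolynomial.C (patB f i j : ℂ) *
    (MvPolynomial.X (i, j) - MvPolynomial.C (if i = j then (1 : ℂ) else 0))

/-- The exact separator `u(u-1)/2` of the target pattern. [folklore] -/
noncomputable def sepB (f : Fin 3 → Fin 3 → Bool) : MvPolynomial (Fin 3 × Fin 3) ℂ :=
  MvPolynomial.C (1 / 2 : ℂ) * (linB f * (linB f - MvPolynomial.C 1))

/-- `u` has total degree `≤ 1`. [folklore] -/
theorem totalDegree_linB (f : Fin 3 → Fin 3 → Bool) : (linB f).totalDegree ≤ 1 := by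
  unfold linB
  refine (MvPolynomial.totalDegree_finsetSum _ _).trans (Finset.sup_le fun i _ => ?_)
  refine (MvPolynomial.totalDegree_finsetSum _ _).trans (Finset.sup_le fun j _ => ?_)
  refine (MvPolynomial.totalDegree_mul _ _).trans ?_
  rw [MvPolynomial.totalDegree_C, zero_add]
  refine (MvPolynomial.totalDegree_sub _ _).trans (max_le ?_ ?_)
  · rw [MvPolynomial.totalDegree_X]
  · rw [MvPolynomial.totalDegree_C]; omega

/-- The exact separator is quadratic. [folklore] -/
theorem totalDegree_sepB (f : Fin 3 → Fin 3 → Bool) : (sepB f).totalDegree ≤ 2 := by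
  unfold sepB
  refine (MvPolynomial.totalDegree_mul _ _).trans ?_
  rw [MvPolynomial.totalDegree_C, zero_add]
  refine (MvPolynomial.totalDegree_mul _ _).trans ?_
  have h1 := totalDegree_linB f
  have h2 : (linB f - MvPolynomial.C 1).totalDegree ≤ 1 :=
    (MvPolynomial.totalDegree_sub _ _).trans (max_le h1 (by rw [MvPolynomial.totalDegree_C]; omega))
  omega

/-- `u_{E₀}(I + E) = ⟨E₀, E⟩`, the overlap. [folklore] -/
theorem eval_linB (f g : Fin 3 → Fin 3 → Bool) :
    MvPolynomial.eval (fun ij : Fin 3 × Fin 3 => castM (matB g) ij.1 ij.2) (linB f) = (ov f g : ℂ) := by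
  simp only [linB, ov, ip, castM, matB, map_sum, map_mul, map_sub, MvPolynomial.eval_C,
    MvPolynomial.eval_X, Matrix.of_apply]
  push_cast
  refine Finset.sum_congr rfl fun i _ => Finset.sum_congr rfl fun j _ => by ring

/-- The separator of `E₀` at `I + E` is `⟨E₀,E⟩(⟨E₀,E⟩ − 1)/2`. [folklore] -/
theorem eval_sepB (f g : Fin 3 → Fin 3 → Bool) :
    MvPolynomial.eval (fun ij : Fin 3 × Fin 3 => castM (matB g) ij.1 ij.2) (sepB f) =
      (1 / 2 : ℂ) * ((ov f g : ℂ) * ((ov f g : ℂ) - 1)) := by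
  simp only [sepB, map_mul, map_sub, MvPolynomial.eval_C, eval_linB]

/-- **The 33-point design, exactly separated in degree 2, at every tolerance.** [folklore] -/
theorem designAt_33 {η : ℝ} (hη : 0 ≤ η) : DesignAt 3 2 33 1 1 η := by
  classical
  set X : Finset (Matrix.GeneralLinearGroup (Fin 3) ℂ) := fam2.image fun f => toGL (matB f) with hX
  have hinj : Set.InjOn (fun f => toGL (matB f)) (fam2 : Set (Fin 3 → Fin 3 → Bool)) := by
    intro f hf g hg h
    exact matB_injective (toGL_inj (fam2_det hf) (fam2_det hg) h)
  have hcard : X.card = 33 := by rw [hX, Finset.card_image_of_injOn hinj, fam2_card]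
  rw [← hcard]
  refine designAt_of_points X fun x₀ hx₀ => ?_
  obtain ⟨f₀, hf₀, rfl⟩ := Finset.mem_image.1 hx₀
  refine ⟨sepB f₀, totalDegree_sepB _, fun x hx => ?_⟩
  obtain ⟨f, hf, rfl⟩ := Finset.mem_image.1 hx
  have hev : MvPolynomial.eval (fun ij : Fin 3 × Fin 3 =>
      ((toGL (matB f) : Matrix.GeneralLinearGroup (Fin 3) ℂ) : Matrix (Fin 3) (Fin 3) ℂ) ij.1 ij.2)
        (sepB f₀) = (1 / 2 : ℂ) * ((ov f₀ f : ℂ) * ((ov f₀ f : ℂ) - 1)) := by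
    rw [val_toGL (fam2_det hf)]
    exact eval_sepB _ _
  refine ⟨fun hxx => ?_, fun hxx => ?_⟩
  · have hff : f = f₀ := hinj hf hf₀ hxx
    subst hff
    rw [hev, fam2_ov_self hf]
    norm_num [hη]
  · have hff : f₀ ≠ f := fun h => hxx (by rw [h])
    rcases fam2_ov_ne hf₀ hf hff with h0 | h1
    · rw [hev, h0]; norm_num [hη]
    · rw [hev, h1]; norm_num [hη]

/-- Deleting the binomial factor `C(s+n², n²) ≥ 1` from the bound is a STRENGTHENING of the crux
(the strengthened statement is written out: a parameterless `def … : Prop` would be a named fact).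
[folklore] -/
theorem separationDegreeCost_of_noBinomial
    (h : ∀ n : ℕ, 3 ≤ n → ∀ s : ℕ, 2 ≤ s → ∀ N₁ N₂ N₃ : ℕ,
      (∀ η : ℝ, 0 < η → DesignAt n s N₁ N₂ N₃ η) →
        ((N₁ : ℝ) * N₂ * N₃) ^ (omega ℂ / 3) ≤ (s : ℝ) ^ ((n : ℝ) * (n - 1) / 2 * (omega ℂ - 2))) :
    SeparationDegreeCost := by
  intro n hn s hs N₁ N₂ N₃ hd
  have h1 := h n hn s hs N₁ N₂ N₃ hd
  have hC : (1 : ℝ) ≤ ((s + n ^ 2).choose (n ^ 2) : ℝ) := by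
    exact_mod_cast Nat.choose_pos (Nat.le_add_left _ _)
  have hpow : 0 ≤ (s : ℝ) ^ ((n : ℝ) * (n - 1) / 2 * (omega ℂ - 2)) :=
    Real.rpow_nonneg (Nat.cast_nonneg s) _
  calc ((N₁ : ℝ) * N₂ * N₃) ^ (omega ℂ / 3)
      ≤ (s : ℝ) ^ ((n : ℝ) * (n - 1) / 2 * (omega ℂ - 2)) := h1
    _ = (s : ℝ) ^ ((n : ℝ) * (n - 1) / 2 * (omega ℂ - 2)) * 1 := (mul_one _).symm
    _ ≤ (s : ℝ) ^ ((n : ℝ) * (n - 1) / 2 * (omega ℂ - 2)) * ((s + n ^ 2).choose (n ^ 2) : ℝ) :=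
        mul_le_mul_of_nonneg_left hC hpow

/-- **The binomial factor is load-bearing**: `33^{ω/3} ≥ 33^{2/3} > 8 ≥ 8^{ω−2}` at the exactly
separated 33-point design (`designAt_33`), using only `2 ≤ ω ≤ 3`. [folklore] -/
theorem separationDegreeCost_noBinomial_false :
    ¬ ∀ n : ℕ, 3 ≤ n → ∀ s : ℕ, 2 ≤ s → ∀ N₁ N₂ N₃ : ℕ,
      (∀ η : ℝ, 0 < η → DesignAt n s N₁ N₂ N₃ η) →
        ((N₁ : ℝ) * N₂ * N₃) ^ (omega ℂ / 3) ≤ (s : ℝ) ^ ((n : ℝ) * (n - 1) / 2 * (omega ℂ - 2)) := by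
  intro h
  have h1 := h 3 le_rfl 2 le_rfl 33 1 1 fun η hη => designAt_33 hη.le
  set ω := omega ℂ with hω
  have hω2 : (2 : ℝ) ≤ ω := omega_two_le ℂ
  have hω3 : ω ≤ 3 := omega_le_three' ℂ
  have hexp : ((3 : ℕ) : ℝ) * ((3 : ℕ) - 1) / 2 * (ω - 2) = 3 * (ω - 2) := by push_cast; ring
  have hR : ((2 : ℕ) : ℝ) ^ (((3 : ℕ) : ℝ) * ((3 : ℕ) - 1) / 2 * (ω - 2)) = (8 : ℝ) ^ (ω - 2) := by
    rw [hexp, Real.rpow_mul (by norm_num : (0 : ℝ) ≤ (2 : ℕ))]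
    norm_num
  have hL : (((33 : ℕ) : ℝ) * ((1 : ℕ) : ℝ) * ((1 : ℕ) : ℝ)) = 33 := by norm_num
  rw [hR, hL] at h1
  -- 8^(ω-2) ≤ 8
  have hR8 : (8 : ℝ) ^ (ω - 2) ≤ 8 := by
    have := Real.rpow_le_rpow_of_exponent_le (by norm_num : (1 : ℝ) ≤ 8) (by linarith : ω - 2 ≤ 1)
    rwa [Real.rpow_one] at this
  -- 33^(2/3) ≤ 33^(ω/3)
  have hL33 : (33 : ℝ) ^ ((2 : ℝ) / 3) ≤ (33 : ℝ) ^ (ω / 3) :=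
    Real.rpow_le_rpow_of_exponent_le (by norm_num) (by linarith)
  -- 8 < 33^(2/3) since 8^3 = 512 < 1089 = 33^2
  have h8 : (8 : ℝ) < (33 : ℝ) ^ ((2 : ℝ) / 3) := by
    by_contra hle
    have hle : (33 : ℝ) ^ ((2 : ℝ) / 3) ≤ 8 := le_of_not_gt hle
    have hnn : 0 ≤ (33 : ℝ) ^ ((2 : ℝ) / 3) := Real.rpow_nonneg (by norm_num) _
    have h3 : ((33 : ℝ) ^ ((2 : ℝ) / 3)) ^ (3 : ℝ) ≤ (8 : ℝ) ^ (3 : ℝ) :=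
      Real.rpow_le_rpow hnn hle (by norm_num)
    rw [← Real.rpow_mul (by norm_num)] at h3
    norm_num at h3
  linarith

/-! ## The clause `2 ≤ s`: deleting it makes the crux imply `ω = 2` through `0 ^ 0 = 1` -/

/-- Deleting the clause `2 ≤ s` is a STRENGTHENING of the crux (statement written out). [folklore] -/
theorem separationDegreeCost_of_anyDegree
    (h : ∀ n : ℕ, 3 ≤ n → ∀ s : ℕ, ∀ N₁ N₂ N₃ : ℕ, (∀ η : ℝ, 0 < η → DesignAt n s N₁ N₂ N₃ η) →
      Conclusion n s N₁ N₂ N₃) :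
    SeparationDegreeCost :=
  fun n hn s _ N₁ N₂ N₃ hd => h n hn s N₁ N₂ N₃ hd

/-- **Junk-exponent hazard.** Without `2 ≤ s`, the instance `s = 0`, `X = Y = Z = {1}`, `p = 1` reads
`1 ≤ 0^{3(ω−2)} · 1`, which holds iff `ω = 2` (real `0 ^ 0 = 1`, `0 ^ t = 0` for `t ≠ 0`).  So the
deleted variant implies `ω(ℂ) = 2`: a proof of the crux must use `1 ≤ s` somewhere. [folklore] -/
theorem omega_eq_two_of_separationDegreeCost_anyDegree
    (h : ∀ n : ℕ, 3 ≤ n → ∀ s : ℕ, ∀ N₁ N₂ N₃ : ℕ, (∀ η : ℝ, 0 < η → DesignAt n s N₁ N₂ N₃ η) →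
      Conclusion n s N₁ N₂ N₃) :
    omega ℂ = 2 := by
  have h1 := h 3 le_rfl 0 1 1 1 fun η hη => designAt_one 3 0 hη.le
  unfold Conclusion at h1
  by_contra hne
  have hω2 : (2 : ℝ) ≤ omega ℂ := omega_two_le ℂ
  have hexp : ((3 : ℕ) : ℝ) * ((3 : ℕ) - 1) / 2 * (omega ℂ - 2) ≠ 0 := by
    push_cast
    intro h0
    apply hne
    nlinarith
  rw [Nat.cast_zero, Real.zero_rpow hexp, zero_mul] at h1
  have : (0 : ℝ) < (((1 : ℕ) : ℝ) * ((1 : ℕ) : ℝ) * ((1 : ℕ) : ℝ)) ^ (omega ℂ / 3) := by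
    norm_num
  linarith

end SeparationDegreeCostNeg

end Summit.MatrixMultiplication.MatrixMultiplication.Theorems
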